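import Summits.Langlands.Langlands.Theses.CMRestImageLocusSplit

/-!
# Route CMRestImageLocusSplit — Assembly

The assembly item (stmt-Langlands-28048) of the child route `CMRestImageLocusSplit` (decomp-langlands lens-5 gen 18; V-R refining child
`--refines route-Langlands-EllipticDegreeLadder:CMWitnessRestAutomorphy`, 83rd cell route) for CMREST = `EllipticDegreeLadder.CMWitnessRestAutomorphy` (stmt-Langlands-31036):
`IrreducibleFiveImQuadWitnessAutomorphy → IrreducibleThreeImQuadWitnessAutomorphy → FifteenLocusImQuadWitnessAutomorphy → HigherCMDegreeWitnessAutomorphy → Summit.Langlands.Langlands.Theses.EllipticDegreeLadder.CMWitnessRestAutomorphy`.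

This is literally the type of the route file's sorry-free deciding theorem `Summit.Langlands.Langlands.Theses.CMRestImageLocusSplit.closes`.
Nothing here proves `Langlands` (nor the parent piece): the assembly records only that the items of the route, taken together, imply the parent piece
by name.
-/

set_option linter.dupNamespace false -- project-wide option (lakefile weak.linter.dupNamespace); `Summit.Langlands.Langlands` is the mandated namespace

namespace Summit.Langlands.Langlands.Theorems

/-- **Assembly of route CMRestImageLocusSplit** (stmt-Langlands-28048):
`IrreducibleFiveImQuadWitnessAutomorphy → IrreducibleThreeImQuadWitnessAutomorphy → FifteenLocusImQuadWitnessAutomorphy → HigherCMDegreeWitnessAutomorphy → Summit.Langlands.Langlands.Theses.EllipticDegreeLadder.CMWitnessRestAutomorphy`.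
Proof: unfold `Assembly` and apply the route's deciding theorem `Theses.CMRestImageLocusSplit.closes`. -/
theorem cMRestImageLocusSplit_assembly_proof :
    Summit.Langlands.Langlands.Theses.CMRestImageLocusSplit.Assembly := by
  unfold Summit.Langlands.Langlands.Theses.CMRestImageLocusSplit.Assembly
  exact Summit.Langlands.Langlands.Theses.CMRestImageLocusSplit.closes

end Summit.Langlands.Langlands.Theorems
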